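import Literature.MathematicalPhysics.QuantumLattice.QuantumRotorGroundState
import HarnessLib

/-!
# Ground-state long-range order of quantum rotators — well-definedness layer (proofs)

Companion to `Literature.MathematicalPhysics.QuantumLattice.QuantumRotorGroundState`, which states
the named fact `QuantumRotor.KleinPerez1992_rotorGroundStateLRO` (Klein–Perez, Commun. Math. Phys.
147 (1992), p. 243: ground-state long-range order of the ferromagnetic quantum rotators (2.1) for
`d ≥ 2` and `J/h > α_c(d)`) over a variational vocabulary. This file proves the **Step 0** every
reading of that statement rests on — that the variational objects are genuine numbers and not
junk values of `⨆`/`⨅` over empty or unbounded families: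

* the cell `[-π, π)^Λ` is a measurable product set of volume `(2π)^{|Λ|} ∈ (0, ∞)`
  (`volume_angleCell`);
* trial states exist — the constant wave function, the `J = 0` ground state
  (`nonempty_trialState`); every trial state has finite energy (`energy_lt_top`: a `C¹` wave
  function has bounded energy density on the compact cube `[-π, π]^Λ`), so the ground-state energy
  is finite and near-minimisers exist at every level `δ > 0` (`exists_energy_le`);
* `∫ |Ψ|² = 1` in Bochner form, all correlations `⟨cos(φ_x - φ_y)⟩` lie in `[-1, 1]`
  (`groundStateCorrelation_mem_Icc`, `infiniteVolumeCorrelation_mem_Icc`), the sum rule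
  `⟨cos 0⟩ = 1` at every level (`groundStateCorrelation_self`, `infiniteVolumeCorrelation_self`,
  the normalisation an infrared bound is played against), and each box correlation is dominated by
  the infinite-volume one (`boxCorrelation_le_infiniteVolumeCorrelation`);
* the two forms in which the literature delivers long-range order — a positive lower bound along
  infinitely many sites (`liminf`), or a positive Cesàro mean over the boxes `Λ_L` for infinitely
  many `L` (what reflection positivity and an infrared bound give) — both imply the non-decay
  `¬ G(0, y) → 0` asserted by the named fact (`not_tendsto_zero_of_frequently_le`,
  `not_tendsto_zero_of_boxMean_ge`).

What is NOT here: the substance of the Klein–Perez remark (spectral theory of `H_Λ`, the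
Feynman–Kac/Trotter path-space representation of §3, Ginibre inequalities, reflection positivity
and the `T = 0` infrared bound, and the passage from periodic to free boundary conditions), for
which the source gives no proof ("standard techniques [6]").

## References

* A. Klein, J. F. Perez, *Localization in the ground state of a disordered array of quantum
  rotators*, Commun. Math. Phys. 147 (1992) 241–252, §2 (2.1), (2.3), pp. 242–243 [KleinPerez1992].
-/

noncomputable section

open MeasureTheory Filter Finset
open scoped ENNReal NNReal Topology

namespace Literature.MathematicalPhysics.QuantumLattice

namespace QuantumRotor

variable {Λ : Type} [Fintype Λ] [DecidableEq Λ]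

/-! ### Well-definedness of the variational objects

Step 0 of any proof of `KleinPerez1992_rotorGroundStateLRO`, and of every standard reading of
"long range order": the cell `[-π, π)^Λ` has finite positive volume; trial states exist (the
constant wave function, the ground state at `J = 0`); every trial state has finite energy, so
the ground-state energy is finite and near-minimisers exist for every `δ > 0`; all correlations
lie in `[-1, 1]`; the sum rule `⟨cos 0⟩ = 1`; each box correlation is dominated by the
infinite-volume one; and the two filter-theoretic forms in which long-range order is delivered by
the literature (a positive lower bound along infinitely many sites, or a positive Cesàro mean over
the boxes `Λ_L` for infinitely many `L`, as an infrared bound gives) both imply the non-decay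
asserted by the named fact. [folklore] -/

section WellDefined

omit [Fintype Λ] [DecidableEq Λ] in
/-- The cell `[-π, π)^Λ` is the product of the intervals `[-π, π)`. [folklore] -/
theorem angleCell_eq_pi :
    angleCell Λ = Set.univ.pi fun _ : Λ => Set.Ico (-Real.pi) Real.pi := by
  ext φ; simp [angleCell]

omit [Fintype Λ] [DecidableEq Λ] in
/-- The cell is contained in the compact cube `[-π, π]^Λ`. [folklore] -/
theorem angleCell_subset_Icc :
    angleCell Λ ⊆ Set.univ.pi fun _ : Λ => Set.Icc (-Real.pi) Real.pi := fun _ hφ =>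
  Set.mem_univ_pi.2 fun x => Set.Ico_subset_Icc_self (hφ x)

omit [DecidableEq Λ] in
/-- The cell is a measurable set. [folklore] -/
theorem measurableSet_angleCell : MeasurableSet (angleCell Λ) := by
  rw [angleCell_eq_pi]; exact MeasurableSet.univ_pi fun _ => measurableSet_Ico

omit [DecidableEq Λ] in
/-- `|[-π, π)^Λ| = (2π)^{|Λ|}`. [folklore] -/
theorem volume_angleCell :
    volume (angleCell Λ) = ENNReal.ofReal (2 * Real.pi) ^ Fintype.card Λ := by
  rw [angleCell_eq_pi, volume_pi_pi]
  simp only [Real.volume_Ico, Finset.prod_const, Finset.card_univ]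
  congr 2; ring

omit [DecidableEq Λ] in
/-- The cell has finite volume. [folklore] -/
theorem volume_angleCell_ne_top : volume (angleCell Λ) ≠ ⊤ := by
  rw [volume_angleCell]; exact ENNReal.pow_ne_top ENNReal.ofReal_ne_top

omit [DecidableEq Λ] in
/-- The cell has positive volume. [folklore] -/
theorem volume_angleCell_ne_zero : volume (angleCell Λ) ≠ 0 := by
  rw [volume_angleCell]; exact pow_ne_zero _ (ENNReal.ofReal_pos.2 (by positivity)).ne'

/-- Trial states exist: the constant wave function `|[-π, π)^Λ|^{-1/2}` (the ground state of the
free rotators, `J = 0`). [folklore] -/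
theorem nonempty_trialState : Nonempty (TrialState Λ) := by
  set t : ℝ := (volume (angleCell Λ)).toReal with ht
  have htpos : 0 < t := ENNReal.toReal_pos volume_angleCell_ne_zero volume_angleCell_ne_top
  set c : ℝ := (Real.sqrt t)⁻¹ with hc
  have hc0 : 0 ≤ c := inv_nonneg.2 (Real.sqrt_nonneg _)
  refine ⟨{ ψ := fun _ => (c : ℂ)
            contDiff := analyticOnNhd_const.contDiff
            periodic := fun _ _ => rfl
            norm_eq := ?_ }⟩
  have hcV : ((‖(c : ℂ)‖₊ : ℝ≥0∞)) ^ 2 = (volume (angleCell Λ))⁻¹ := by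
    rw [← enorm_eq_nnnorm, ← ofReal_norm, ← ENNReal.ofReal_pow (norm_nonneg _),
      Complex.norm_real, Real.norm_of_nonneg hc0, hc, inv_pow, Real.sq_sqrt htpos.le,
      ENNReal.ofReal_inv_of_pos htpos, ht, ENNReal.ofReal_toReal volume_angleCell_ne_top]
  show ∫⁻ _ in angleCell Λ, ((‖(c : ℂ)‖₊ : ℝ≥0∞)) ^ 2 = 1
  rw [setLIntegral_const, hcV,
    ENNReal.inv_mul_cancel volume_angleCell_ne_zero volume_angleCell_ne_top]

/-- Every trial state has finite energy: the wave function is `C¹`, so the integrand is bounded on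
the compact cube `[-π, π]^Λ ⊇ [-π, π)^Λ`, and the cell has finite volume. [folklore] -/
theorem energy_lt_top (h J : ℝ) (nn : Λ → Λ → Prop) [DecidableRel nn] (Ψ : TrialState Λ) :
    energy h J nn Ψ < ⊤ := by
  have hK : IsCompact (Set.univ.pi fun _ : Λ => Set.Icc (-Real.pi) Real.pi) :=
    isCompact_univ_pi fun _ => isCompact_Icc
  obtain ⟨M, hM⟩ := hK.exists_bound_of_continuousOn
    (Ψ.contDiff.continuous_fderiv one_ne_zero).continuousOn
  obtain ⟨N, hN⟩ := hK.exists_bound_of_continuousOn Ψ.contDiff.continuous.continuousOn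
  set S₀ : ℝ := ∑ x : Λ, ∑ _y ∈ univ.filter (nn x), (2 : ℝ) with hS₀
  set C : ℝ≥0∞ := ENNReal.ofReal (h / 2) * ((Fintype.card Λ : ℝ≥0∞) * ENNReal.ofReal (M ^ 2)) +
      ENNReal.ofReal (|J| / 2 * S₀) * ENNReal.ofReal (N ^ 2) with hC
  have hCtop : C ≠ ⊤ :=
    ENNReal.add_ne_top.2 ⟨ENNReal.mul_ne_top ENNReal.ofReal_ne_top
      (ENNReal.mul_ne_top (ENNReal.natCast_ne_top _) ENNReal.ofReal_ne_top),
      ENNReal.mul_ne_top ENNReal.ofReal_ne_top ENNReal.ofReal_ne_top⟩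
  refine setLIntegral_lt_top_of_le_nnreal volume_angleCell_ne_top ⟨C.toNNReal, fun φ hφ => ?_⟩
  rw [ENNReal.coe_toNNReal hCtop]
  have hφK : φ ∈ Set.univ.pi fun _ : Λ => Set.Icc (-Real.pi) Real.pi := angleCell_subset_Icc hφ
  have key : ∀ (v : ℂ) (r : ℝ), ‖v‖ ≤ r → ((‖v‖₊ : ℝ≥0∞)) ^ 2 ≤ ENNReal.ofReal (r ^ 2) := by
    intro v r hv
    rw [← enorm_eq_nnnorm, ← ofReal_norm, ← ENNReal.ofReal_pow (norm_nonneg _)]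
    exact ENNReal.ofReal_le_ofReal (pow_le_pow_left₀ (norm_nonneg _) hv 2)
  have h1 : ∀ x : Λ,
      ((‖fderiv ℝ Ψ.ψ φ (Pi.single x 1)‖₊ : ℝ≥0∞)) ^ 2 ≤ ENNReal.ofReal (M ^ 2) := by
    intro x
    refine key _ _ ?_
    have hsingle : ‖(Pi.single x (1 : ℝ) : Λ → ℝ)‖ = 1 := by rw [Pi.norm_single, norm_one]
    calc ‖fderiv ℝ Ψ.ψ φ (Pi.single x 1)‖
        ≤ ‖fderiv ℝ Ψ.ψ φ‖ * ‖(Pi.single x (1 : ℝ) : Λ → ℝ)‖ := ContinuousLinearMap.le_opNorm _ _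
      _ ≤ M := by rw [hsingle, mul_one]; exact hM φ hφK
  have h2 : ((‖Ψ.ψ φ‖₊ : ℝ≥0∞)) ^ 2 ≤ ENNReal.ofReal (N ^ 2) := key _ _ (hN φ hφK)
  have h3 : ENNReal.ofReal ((J / 2) * ∑ x, ∑ y ∈ univ.filter (nn x), (1 - Real.cos (φ x - φ y))) ≤
      ENNReal.ofReal (|J| / 2 * S₀) := by
    refine ENNReal.ofReal_le_ofReal ?_
    have hS : 0 ≤ ∑ x, ∑ y ∈ univ.filter (nn x), (1 - Real.cos (φ x - φ y)) :=
      Finset.sum_nonneg fun x _ => Finset.sum_nonneg fun y _ => sub_nonneg.2 (Real.cos_le_one _)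
    have hS' : ∑ x, ∑ y ∈ univ.filter (nn x), (1 - Real.cos (φ x - φ y)) ≤ S₀ :=
      Finset.sum_le_sum fun x _ => Finset.sum_le_sum fun y _ => by
        linarith [Real.neg_one_le_cos (φ x - φ y)]
    calc J / 2 * ∑ x, ∑ y ∈ univ.filter (nn x), (1 - Real.cos (φ x - φ y))
        ≤ |J| / 2 * ∑ x, ∑ y ∈ univ.filter (nn x), (1 - Real.cos (φ x - φ y)) :=
          mul_le_mul_of_nonneg_right (by linarith [le_abs_self J]) hS
      _ ≤ |J| / 2 * S₀ := mul_le_mul_of_nonneg_left hS' (by positivity)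
  calc ENNReal.ofReal (h / 2) * (∑ x, ((‖fderiv ℝ Ψ.ψ φ (Pi.single x 1)‖₊ : ℝ≥0∞)) ^ 2) +
        ENNReal.ofReal ((J / 2) * ∑ x, ∑ y ∈ univ.filter (nn x), (1 - Real.cos (φ x - φ y))) *
          ((‖Ψ.ψ φ‖₊ : ℝ≥0∞)) ^ 2
      ≤ ENNReal.ofReal (h / 2) * (∑ _x : Λ, ENNReal.ofReal (M ^ 2)) +
        ENNReal.ofReal (|J| / 2 * S₀) * ENNReal.ofReal (N ^ 2) :=
        add_le_add (mul_le_mul' le_rfl (Finset.sum_le_sum fun x _ => h1 x)) (mul_le_mul' h3 h2)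
    _ = C := by rw [Finset.sum_const, Finset.card_univ, nsmul_eq_mul]

/-- The (shifted) ground-state energy is finite. [folklore] -/
theorem groundStateEnergy_ne_top (h J : ℝ) (nn : Λ → Λ → Prop) [DecidableRel nn] :
    groundStateEnergy h J nn ≠ ⊤ :=
  ((iInf_le _ (nonempty_trialState (Λ := Λ)).some).trans_lt (energy_lt_top h J nn _)).ne

/-- Near-minimisers exist: for every `δ > 0` some trial state has energy `≤ E₀ + δ`. [folklore] -/
theorem exists_energy_le (h J : ℝ) (nn : Λ → Λ → Prop) [DecidableRel nn] {δ : ℝ} (hδ : 0 < δ) :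
    ∃ Ψ : TrialState Λ, energy h J nn Ψ ≤ groundStateEnergy h J nn + ENNReal.ofReal δ := by
  obtain ⟨Ψ, hΨ⟩ := iInf_lt_iff.1 (ENNReal.lt_add_right (groundStateEnergy_ne_top h J nn)
    (ENNReal.ofReal_pos.2 hδ).ne')
  exact ⟨Ψ, hΨ.le⟩

/-- The index type of the inner supremum in `groundStateCorrelation` is inhabited. [folklore] -/
theorem nonempty_nearMinimiser (h J : ℝ) (nn : Λ → Λ → Prop) [DecidableRel nn] {δ : ℝ}
    (hδ : 0 < δ) :
    Nonempty {Ψ : TrialState Λ // energy h J nn Ψ ≤ groundStateEnergy h J nn + ENNReal.ofReal δ} :=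
  let ⟨Ψ, hΨ⟩ := exists_energy_le h J nn hδ
  ⟨⟨Ψ, hΨ⟩⟩

/-- `|Ψ|²` is integrable on the cell. [folklore] -/
theorem integrable_norm_sq (Ψ : TrialState Λ) :
    Integrable (fun φ => ‖Ψ.ψ φ‖ ^ 2) (volume.restrict (angleCell Λ)) := by
  refine ⟨(Ψ.contDiff.continuous.norm.pow 2).aestronglyMeasurable, ?_⟩
  have hφ : ∀ φ, ‖‖Ψ.ψ φ‖ ^ 2‖ₑ = ((‖Ψ.ψ φ‖₊ : ℝ≥0∞)) ^ 2 := fun φ => by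
    rw [Real.enorm_eq_ofReal (sq_nonneg _), ENNReal.ofReal_pow (norm_nonneg _), ofReal_norm,
      enorm_eq_nnnorm]
  simp only [HasFiniteIntegral, hφ, Ψ.norm_eq, ENNReal.one_lt_top]

/-- Normalisation in Bochner form: `∫_{[-π,π)^Λ} |Ψ|² = 1`. [folklore] -/
theorem integral_norm_sq_eq_one (Ψ : TrialState Λ) : ∫ φ in angleCell Λ, ‖Ψ.ψ φ‖ ^ 2 = 1 := by
  rw [integral_eq_lintegral_of_nonneg_ae (Eventually.of_forall fun φ => sq_nonneg _)
    (Ψ.contDiff.continuous.norm.pow 2).aestronglyMeasurable]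
  have hφ : ∀ φ, ENNReal.ofReal (‖Ψ.ψ φ‖ ^ 2) = ((‖Ψ.ψ φ‖₊ : ℝ≥0∞)) ^ 2 := fun φ => by
    rw [ENNReal.ofReal_pow (norm_nonneg _), ofReal_norm, enorm_eq_nnnorm]
  simp only [hφ, Ψ.norm_eq, ENNReal.toReal_one]

/-- `|⟨cos(φ(x) - φ(y))⟩_Ψ| ≤ 1` in every trial state. [folklore] -/
theorem abs_cosCorrelation_le_one (Ψ : TrialState Λ) (x y : Λ) : |cosCorrelation Ψ x y| ≤ 1 := by
  rw [cosCorrelation, ← Real.norm_eq_abs, ← integral_norm_sq_eq_one Ψ]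
  refine norm_integral_le_of_norm_le (integrable_norm_sq Ψ) (Eventually.of_forall fun φ => ?_)
  rw [norm_mul, Real.norm_of_nonneg (sq_nonneg _)]
  exact mul_le_of_le_one_left (sq_nonneg _)
    ((Real.norm_eq_abs _).le.trans (Real.abs_cos_le_one _))

/-- `⟨cos(φ(x) - φ(y))⟩_Ψ ≤ 1`. [folklore] -/
theorem cosCorrelation_le_one (Ψ : TrialState Λ) (x y : Λ) : cosCorrelation Ψ x y ≤ 1 :=
  (abs_le.1 (abs_cosCorrelation_le_one Ψ x y)).2

/-- `-1 ≤ ⟨cos(φ(x) - φ(y))⟩_Ψ`. [folklore] -/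
theorem neg_one_le_cosCorrelation (Ψ : TrialState Λ) (x y : Λ) : -1 ≤ cosCorrelation Ψ x y :=
  (abs_le.1 (abs_cosCorrelation_le_one Ψ x y)).1

/-- The correlation is symmetric in the two sites (`cos` is even). [folklore] -/
theorem cosCorrelation_comm (Ψ : TrialState Λ) (x y : Λ) :
    cosCorrelation Ψ x y = cosCorrelation Ψ y x := by
  unfold cosCorrelation
  congr 1; funext φ
  rw [← Real.cos_neg, neg_sub]

/-- Sum rule `⟨cos(φ(x) - φ(x))⟩_Ψ = ⟨1⟩_Ψ = 1`. [folklore] -/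
theorem cosCorrelation_self (Ψ : TrialState Λ) (x : Λ) : cosCorrelation Ψ x x = 1 := by
  simp only [cosCorrelation, sub_self, Real.cos_zero, one_mul, integral_norm_sq_eq_one]

/-- The inner supremum of `groundStateCorrelation` (over the near-minimisers at level `δ`) lies in
`[-1, 1]`. [folklore] -/
theorem iSup_nearMinimiser_mem_Icc (h J : ℝ) (nn : Λ → Λ → Prop) [DecidableRel nn] (x y : Λ)
    (δ : {δ : ℝ // 0 < δ}) :
    (⨆ Ψ : {Ψ : TrialState Λ // energy h J nn Ψ ≤ groundStateEnergy h J nn + ENNReal.ofReal δ.1},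
      cosCorrelation Ψ.1 x y) ∈ Set.Icc (-1 : ℝ) 1 := by
  haveI := nonempty_nearMinimiser h J nn δ.2
  refine ⟨le_ciSup_of_le ⟨1, ?_⟩ (Classical.arbitrary _) (neg_one_le_cosCorrelation _ _ _),
    ciSup_le fun Ψ => cosCorrelation_le_one _ _ _⟩
  rintro _ ⟨Ψ, rfl⟩
  exact cosCorrelation_le_one _ _ _

/-- The ground-state correlation lies in `[-1, 1]` (it is a genuine `inf` of genuine `sup`s of
numbers in `[-1, 1]`: near-minimisers exist at every level `δ > 0`). [folklore] -/
theorem groundStateCorrelation_mem_Icc (h J : ℝ) (nn : Λ → Λ → Prop) [DecidableRel nn] (x y : Λ) :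
    groundStateCorrelation h J nn x y ∈ Set.Icc (-1 : ℝ) 1 := by
  haveI : Nonempty {δ : ℝ // 0 < δ} := ⟨⟨1, one_pos⟩⟩
  simp only [groundStateCorrelation, Set.mem_Icc]
  refine ⟨le_ciInf fun δ => (iSup_nearMinimiser_mem_Icc h J nn x y δ).1,
    ciInf_le_of_le ⟨-1, ?_⟩ ⟨1, one_pos⟩ (iSup_nearMinimiser_mem_Icc h J nn x y _).2⟩
  rintro _ ⟨δ, rfl⟩
  exact (iSup_nearMinimiser_mem_Icc h J nn x y δ).1

/-- `|⟨cos(φ(x) - φ(y))⟩_Λ| ≤ 1`. [folklore] -/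
theorem abs_groundStateCorrelation_le_one (h J : ℝ) (nn : Λ → Λ → Prop) [DecidableRel nn]
    (x y : Λ) : |groundStateCorrelation h J nn x y| ≤ 1 :=
  abs_le.2 (groundStateCorrelation_mem_Icc h J nn x y)

/-- Sum rule for the ground state: `⟨cos(φ(x) - φ(x))⟩_Λ = 1` (the `k`-space normalisation
`Σ_k ĝ(k) = 1` that an infrared bound is played against). [folklore] -/
theorem groundStateCorrelation_self (h J : ℝ) (nn : Λ → Λ → Prop) [DecidableRel nn] (x : Λ) :
    groundStateCorrelation h J nn x x = 1 := by
  haveI : Nonempty {δ : ℝ // 0 < δ} := ⟨⟨1, one_pos⟩⟩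
  have hδ : ∀ δ : {δ : ℝ // 0 < δ},
      (⨆ Ψ : {Ψ : TrialState Λ // energy h J nn Ψ ≤ groundStateEnergy h J nn + ENNReal.ofReal δ.1},
        cosCorrelation Ψ.1 x x) = 1 := fun δ => by
    haveI := nonempty_nearMinimiser h J nn δ.2
    simp only [cosCorrelation_self, ciSup_const]
  simp only [groundStateCorrelation, hδ, ciInf_const]

end WellDefined

/-! ### Boxes: bounds, the sum rule, and the two standard forms of long-range order -/

section Boxes

open Literature.Probability.LatticeModels

/-- `|⟨cos(φ(x) - φ(y))⟩_{Λ_L}| ≤ 1`. [folklore] -/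
theorem abs_boxCorrelation_le_one (d L : ℕ) (h J : ℝ) (x y : BoxSite d L) :
    |boxCorrelation d L h J x y| ≤ 1 :=
  abs_groundStateCorrelation_le_one h J _ x y

/-- Sum rule in a box: `⟨cos(φ(x) - φ(x))⟩_{Λ_L} = 1`. [folklore] -/
theorem boxCorrelation_self (d L : ℕ) (h J : ℝ) (x : BoxSite d L) :
    boxCorrelation d L h J x x = 1 :=
  groundStateCorrelation_self h J _ x

/-- Any two sites lie in a common box `Λ_L`. [folklore] -/
theorem exists_mem_box_and {d : ℕ} (x y : Fin d → ℤ) : ∃ L : ℕ, x ∈ box d L ∧ y ∈ box d L := by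
  have hmem : ∀ z : Fin d → ℤ, z ∈ ⋃ L : ℕ, ((box d L : Finset (Site d)) : Set (Site d)) :=
    fun z => by rw [iUnion_coe_box]; exact Set.mem_univ z
  obtain ⟨Lx, hLx⟩ := Set.mem_iUnion.1 (hmem x)
  obtain ⟨Ly, hLy⟩ := Set.mem_iUnion.1 (hmem y)
  exact ⟨max Lx Ly, box_mono d (le_max_left _ _) hLx, box_mono d (le_max_right _ _) hLy⟩

/-- The box correlations entering `infiniteVolumeCorrelation` are bounded above (by `1`), so the
supremum defining it is a genuine one. [folklore] -/
theorem bddAbove_range_boxCorrelation (d : ℕ) (h J : ℝ) (x y : Fin d → ℤ) :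
    BddAbove (Set.range fun L : {L : ℕ // x ∈ box d L ∧ y ∈ box d L} =>
      boxCorrelation d L.1 h J ⟨x, L.2.1⟩ ⟨y, L.2.2⟩) :=
  ⟨1, by rintro _ ⟨L, rfl⟩; exact (abs_le.1 (abs_boxCorrelation_le_one _ _ _ _ _ _)).2⟩

/-- Each finite-volume correlation is dominated by the infinite-volume one. [folklore] -/
theorem boxCorrelation_le_infiniteVolumeCorrelation (d L : ℕ) (h J : ℝ) {x y : Fin d → ℤ}
    (hx : x ∈ box d L) (hy : y ∈ box d L) :
    boxCorrelation d L h J ⟨x, hx⟩ ⟨y, hy⟩ ≤ infiniteVolumeCorrelation d h J x y :=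
  le_ciSup (f := fun L : {L : ℕ // x ∈ box d L ∧ y ∈ box d L} =>
    boxCorrelation d L.1 h J ⟨x, L.2.1⟩ ⟨y, L.2.2⟩) (bddAbove_range_boxCorrelation d h J x y)
    ⟨L, hx, hy⟩

/-- The infinite-volume ground-state correlation lies in `[-1, 1]`. [folklore] -/
theorem infiniteVolumeCorrelation_mem_Icc (d : ℕ) (h J : ℝ) (x y : Fin d → ℤ) :
    infiniteVolumeCorrelation d h J x y ∈ Set.Icc (-1 : ℝ) 1 := by
  obtain ⟨L, hx, hy⟩ := exists_mem_box_and x y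
  exact ⟨(abs_le.1 (abs_boxCorrelation_le_one d L h J ⟨x, hx⟩ ⟨y, hy⟩)).1.trans
      (boxCorrelation_le_infiniteVolumeCorrelation d L h J hx hy),
    Real.iSup_le (fun L => (abs_le.1 (abs_boxCorrelation_le_one _ _ _ _ _ _)).2) zero_le_one⟩

/-- Sum rule in infinite volume: `G(x, x) = 1`. [folklore] -/
theorem infiniteVolumeCorrelation_self (d : ℕ) (h J : ℝ) (x : Fin d → ℤ) :
    infiniteVolumeCorrelation d h J x x = 1 := by
  obtain ⟨L, hx, -⟩ := exists_mem_box_and x x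
  haveI : Nonempty {L : ℕ // x ∈ box d L ∧ x ∈ box d L} := ⟨⟨L, hx, hx⟩⟩
  simp only [infiniteVolumeCorrelation, boxCorrelation_self, ciSup_const]

/-- Long-range order in the `liminf` form implies the non-decay form of the named fact: if
`G ≥ c > 0` frequently along a filter `l`, then `G` does not tend to `0` along `l`. [folklore] -/
theorem not_tendsto_zero_of_frequently_le {ι : Type*} {l : Filter ι} {G : ι → ℝ} {c : ℝ}
    (hc : 0 < c) (hG : ∃ᶠ y in l, c ≤ G y) : ¬ Tendsto G l (𝓝 0) := fun hT =>
  hG ((NormedAddGroup.tendsto_nhds_zero.1 hT c hc).mono fun y hy hcy =>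
    lt_irrefl c (hcy.trans_lt ((le_abs_self _).trans_lt (by simpa [Real.norm_eq_abs] using hy))))

/-- Long-range order in the Cesàro form implies the non-decay form of the named fact: if a
function `G ≤ 1` on `ℤ^d`, `d ≥ 1`, has box means `|Λ_L|⁻¹ Σ_{y ∈ Λ_L} G(y) ≥ c > 0` for
infinitely many `L` (the form of long-range order an infrared bound delivers), then `G(y)` does
not tend to `0` as `y → ∞`. [folklore] -/
theorem not_tendsto_zero_of_boxMean_ge {d : ℕ} (hd : 1 ≤ d) {G : (Fin d → ℤ) → ℝ} {c : ℝ}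
    (hc : 0 < c) (hG1 : ∀ y, G y ≤ 1)
    (hG : ∃ᶠ L in atTop, c * (box d L).card ≤ ∑ y ∈ box d L, G y) :
    ¬ Tendsto G cofinite (𝓝 0) := by
  classical
  intro hT
  have hev := NormedAddGroup.tendsto_nhds_zero.1 hT (c / 2) (half_pos hc)
  rw [Filter.eventually_cofinite] at hev
  set S : Finset (Fin d → ℤ) := hev.toFinset with hS
  -- off the finite set `S` we have `|G| < c / 2`, so every box sum is at most `#S + (c/2) |Λ_L|`
  have hbound : ∀ L, ∑ y ∈ box d L, G y ≤ S.card + c / 2 * (box d L).card := by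
    intro L
    rw [← Finset.sum_filter_add_sum_filter_not (box d L) (· ∈ S)]
    refine add_le_add ?_ ?_
    · calc ∑ y ∈ (box d L).filter (· ∈ S), G y
          ≤ ∑ _y ∈ (box d L).filter (· ∈ S), (1 : ℝ) := Finset.sum_le_sum fun y _ => hG1 y
        _ = ((box d L).filter (· ∈ S)).card := by simp
        _ ≤ S.card := by
          exact_mod_cast Finset.card_le_card fun y hy => (Finset.mem_filter.1 hy).2
    · calc ∑ y ∈ (box d L).filter (fun y => ¬ y ∈ S), G y
          ≤ ∑ _y ∈ (box d L).filter (fun y => ¬ y ∈ S), c / 2 :=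
            Finset.sum_le_sum fun y hy => by
              have hyS : y ∉ S := (Finset.mem_filter.1 hy).2
              have hlt : ‖G y‖ < c / 2 := by
                by_contra hcon
                exact hyS (by simpa [hS, Set.Finite.mem_toFinset] using hcon)
              exact ((le_abs_self _).trans_lt (by simpa [Real.norm_eq_abs] using hlt)).le
        _ = c / 2 * ((box d L).filter (fun y => ¬ y ∈ S)).card := by
            rw [Finset.sum_const, nsmul_eq_mul, mul_comm]
        _ ≤ c / 2 * (box d L).card := by
            gcongr
            exact Finset.filter_subset _ _
  -- a box `Λ_L` with the Cesàro bound and `L > 2 #S / c` is contradictory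
  obtain ⟨L, hL, hLc⟩ :=
    (hG.and_eventually (eventually_gt_atTop ⌈2 * (S.card : ℝ) / c⌉₊)).exists
  have hcard : (L : ℝ) ≤ (box d L).card := by
    rw [card_box]
    exact_mod_cast (show L ≤ 2 * L + 1 by omega).trans (Nat.le_self_pow (by omega) _)
  have hA : c * (L : ℝ) ≤ c * (box d L).card := mul_le_mul_of_nonneg_left hcard hc.le
  have hB : 2 * (S.card : ℝ) < c * L := (div_lt_iff₀' hc).1 ((Nat.le_ceil _).trans_lt
    (by exact_mod_cast hLc))
  have hE : c / 2 * ((box d L).card : ℝ) = (1 / 2) * (c * (box d L).card) := by ring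
  have hX := hbound L
  linarith

end Boxes

/-! ### Periodic boundary conditions: the torus correlation, and the proof route of the torus theorem

`torusCorrelation d L h J` (`QuantumRotorGroundState.lean`) — the ground-state correlation of
(2.1) on the discrete torus `(ℤ/Lℤ)^d` — is the object of the published long-range-order theorems
[WojtkiewiczPuszStachura2016, Thm. 3.3; Wojtkiewicz2012, Thm. 1] (see the section docstring
"Periodic boundary conditions: what the cited proofs establish" of that file). Its elementary
properties follow from the general lemmas above (any neighbour relation): values in `[-1, 1]`,
symmetry, the sum rule on the diagonal, and hence the order-parameter density
`|Λ_L|⁻² Σ_{x,y ∈ Λ_L} ⟨cos(φ_x - φ_y)⟩_{Λ_L} ∈ [-1, 1]`, whose `liminf` along the even tori is the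
`HasLongRangeOrder` quantity of the corrected statement (`hasLongRangeOrder_torusCorrelation_iff`).

**Proof route of the torus theorem against the tree (recorded here, not formalised).** The
printed proof [WojtkiewiczPuszStachura2016, §§3.3–3.4] — sum rule `Σ_k g_k = |Λ|/2`,
`g_k² ≤ χ_k 𝓓_k`, the double-commutator bound `𝓓_k ≤ 1/(4I)` from the kinetic term, and
`χ_k ≲ √(I/J)/√𝓔(k)` from Gaussian domination `E₀(b) ≥ E₀(0)` (Thm. 3.5, by the operator
Kennedy–Lieb–Shastry inequality, Thm. 2.3, after the map `φ_x ↦ -φ_x` on one sublattice of the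
even torus) — is the Kennedy–Lieb–Shastry `T = 0` scheme that the tree formalises completely for
the quantum XY model (`kennedy_lieb_shastry_xy_ground_holds`, files `XYOrder*Proofs.lean`). Two
finite-dimensional reductions make that machinery bear on the variational rendering
`groundStateCorrelation` used here, with no spectral theory of the unbounded `H_Λ`:

1. *Fourier truncation.* On the modes `|n_x| ≤ M` (local dimension `2M + 1`), in the momentum
   basis `e^{iφ}` is a real shift matrix, so `cos φ` and `i sin φ` are REAL matrices and
   `(h/2) N²` is real diagonal — the reality structure (`S¹` and `iS²` real) under which
   `Matrix.kls_groundEnergy_reflection` (`XYOrderGDProofs.lean`, abstract ground-state reflection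
   positivity) gives Gaussian domination once the sublattice map has turned every bond
   `cos(φ_x - φ_y)` of the bipartite even torus into `cos φ_x ⊗ cos φ_y + (i sin φ_x) ⊗ (i sin φ_y)`;
   the torus-splitting geometry of `XYOrderReflection.lean` is model-independent. Truncation
   commutes with the global rotations `φ ↦ φ + α` (diagonal phases), so `⟨cos·cos⟩ = ⟨sin·sin⟩`
   structure factors still agree (the analogue of [ibid., Lemma 3.4]); the truncated sum rule
   `(P cos φ_x P)² + (P sin φ_x P)² = P - (defect supported on |n_x| = M)` holds up to a term of
   ground-state weight `≤ ⟨N_x²⟩/M²` (Chebyshev), and `(h/2) Σ_x ⟨N_x²⟩ ≤ J · #bonds` because the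
   constant wave function has energy `≤` that of the ground state's potential part — a defect
   `O(dJ/(hM²))` per site, uniform in the volume. The Riemann sums of `𝓔(k)^{-1/2}`,
   `𝓔(k) = Σᵢ (1 - cos kᵢ)`, over the punctured dual torus are bounded uniformly in `L` iff `d ≥ 2`
   (cf. `klsRiemannSum_tendsto` for the XY integrand), which is where `d ≥ 2` and the threshold
   `J/h > α_c(d)` enter.
2. *Variational bridge.* A ground vector `Ω_M` of the truncated torus Hamiltonian (chosen in the
   ground eigenspace so that `Σ_{x,y} ⟨Ω_M, cos(φ_x - φ_y) Ω_M⟩` is at least its tracial average) is a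
   trigonometric polynomial, hence a `TrialState`, and by the finite Parseval identity
   `∫_{[-π,π)^Λ} e^{i n·φ} dφ = (2π)^{|Λ|} δ_{n,0}` its `energy` and `cosCorrelation` are the matrix
   quantities. Trigonometric polynomials are dense in the `C¹` trial states for the energy form
   (convolution with the positive trigonometric kernels `c_M ∏_x (1 + cos φ_x)^M`, an approximate
   identity commuting with each `∂/∂φ_x`), so the truncated ground-state energies decrease to
   `groundStateEnergy`. Consequently `Ω_M` is a near-minimiser at every level `δ > 0` for all
   `M ≥ M₀(δ)`, whence `groundStateCorrelation h J nn x y ≥ limsup_M ⟨Ω_M, cos(φ_x - φ_y) Ω_M⟩` for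
   every pair (the `inf`–`sup` rendering is monotone in the right direction), and summing over
   pairs (`limsup` is subadditive) `Σ_{x,y} torusCorrelation ≥ limsup_M Σ_{x,y} ⟨Ω_M, … Ω_M⟩ ≥ 2C|Λ|²`
   by the truncated bound of step 1 — uniqueness of the ground state, a spectral gap and elliptic
   regularity of `H_Λ` are never needed. -/

section Torus

open Literature.Probability.LatticeModels

/-- The ground-state correlation is symmetric in the two sites (any neighbour relation).
[folklore] -/
theorem groundStateCorrelation_comm (h J : ℝ) (nn : Λ → Λ → Prop) [DecidableRel nn] (x y : Λ) :
    groundStateCorrelation h J nn x y = groundStateCorrelation h J nn y x := by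
  unfold groundStateCorrelation
  exact iInf_congr fun δ => iSup_congr fun Ψ => cosCorrelation_comm _ _ _

/-- The torus correlation `⟨cos(φ(x) - φ(y))⟩_{(ℤ/Lℤ)^d}` lies in `[-1, 1]` (junk `0` at `L = 0`
included). [folklore] -/
theorem torusCorrelation_mem_Icc (d L : ℕ) (h J : ℝ) (x y : TorusSite d L) :
    torusCorrelation d L h J x y ∈ Set.Icc (-1 : ℝ) 1 := by
  rcases eq_or_ne L 0 with rfl | hL
  · simp
  · haveI : NeZero L := ⟨hL⟩
    rw [torusCorrelation_of_neZero]
    exact groundStateCorrelation_mem_Icc h J _ x y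

/-- `|⟨cos(φ(x) - φ(y))⟩_{(ℤ/Lℤ)^d}| ≤ 1`. [folklore] -/
theorem abs_torusCorrelation_le_one (d L : ℕ) (h J : ℝ) (x y : TorusSite d L) :
    |torusCorrelation d L h J x y| ≤ 1 :=
  abs_le.2 (torusCorrelation_mem_Icc d L h J x y)

/-- The torus correlation is symmetric in the two sites. [folklore] -/
theorem torusCorrelation_comm (d L : ℕ) (h J : ℝ) (x y : TorusSite d L) :
    torusCorrelation d L h J x y = torusCorrelation d L h J y x := by
  rcases eq_or_ne L 0 with rfl | hL
  · simp
  · haveI : NeZero L := ⟨hL⟩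
    rw [torusCorrelation_of_neZero, torusCorrelation_of_neZero, groundStateCorrelation_comm]

/-- Sum rule on a genuine torus: `⟨cos(φ(x) - φ(x))⟩_{(ℤ/Lℤ)^d} = 1` (the `Σ_k` normalisation of
the structure factor, [WojtkiewiczPuszStachura2016, §3.3, `Σ_k g_k = |Λ|/2` for each of cos, sin]).
[folklore] -/
theorem torusCorrelation_self (d L : ℕ) [NeZero L] (h J : ℝ) (x : TorusSite d L) :
    torusCorrelation d L h J x x = 1 := by
  rw [torusCorrelation_of_neZero, groundStateCorrelation_self]

/-- The order-parameter density `|Λ_L|⁻² Σ_{x,y ∈ Λ_L} ⟨cos(φ_x - φ_y)⟩_{(ℤ/Lℤ)^d}` (pulled back to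
the fundamental domain `halfOpenBox d L`, as in `HasLongRangeOrder`) has absolute value at most
`1`; in particular the `liminf` defining long-range order of `torusCorrelation` is that of a
bounded sequence. [folklore] -/
theorem abs_torusOrderParameter_le_one (d L : ℕ) (h J : ℝ) :
    |(∑ x ∈ halfOpenBox d L, ∑ y ∈ halfOpenBox d L,
        torusPullback (fun L x y => torusCorrelation d L h J x y) L x y) /
      ((halfOpenBox d L).card : ℝ) ^ 2| ≤ 1 := by
  have hS : |∑ x ∈ halfOpenBox d L, ∑ y ∈ halfOpenBox d L,
      torusPullback (fun L x y => torusCorrelation d L h J x y) L x y| ≤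
      ((halfOpenBox d L).card : ℝ) ^ 2 := by
    calc |∑ x ∈ halfOpenBox d L, ∑ y ∈ halfOpenBox d L,
            torusPullback (fun L x y => torusCorrelation d L h J x y) L x y|
        ≤ ∑ x ∈ halfOpenBox d L, |∑ y ∈ halfOpenBox d L,
            torusPullback (fun L x y => torusCorrelation d L h J x y) L x y| :=
          Finset.abs_sum_le_sum_abs _ _
      _ ≤ ∑ x ∈ halfOpenBox d L, ∑ y ∈ halfOpenBox d L,
            |torusPullback (fun L x y => torusCorrelation d L h J x y) L x y| :=
          Finset.sum_le_sum fun x _ => Finset.abs_sum_le_sum_abs _ _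
      _ ≤ ∑ _x ∈ halfOpenBox d L, ∑ _y ∈ halfOpenBox d L, (1 : ℝ) :=
          Finset.sum_le_sum fun x _ => Finset.sum_le_sum fun y _ => by
            rw [torusPullback_apply]
            exact abs_torusCorrelation_le_one _ _ _ _ _ _
      _ = ((halfOpenBox d L).card : ℝ) ^ 2 := by simp [sq]
  rcases eq_or_ne ((halfOpenBox d L).card : ℝ) 0 with h0 | h0
  · rw [h0]
    simp
  · have hc : (0 : ℝ) < ((halfOpenBox d L).card : ℝ) ^ 2 :=
      pow_pos (lt_of_le_of_ne (Nat.cast_nonneg _) (Ne.symm h0)) 2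
    rw [abs_div, abs_of_pos hc, div_le_one hc]
    exact hS

end Torus

end QuantumRotor

end Literature.MathematicalPhysics.QuantumLattice

end
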